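import Literature.NumberTheory.Automorphic.QuaternionMaximalOrder
import Literature.NumberTheory.Automorphic.QuaternionAlgebraExistenceReciprocity
import Literature.NumberTheory.Automorphic.BrandtModuleDictionary
import HarnessLib

/-!
# Brandt setups of level `(1, N⁻)` exist: `brandtXi 1 N⁻` and `brandtModule 1 N⁻` are not junk

Topic `NumberTheory/Automorphic`; theorems only (no definition, no named fact, no instance).
A brick of the Brandt-module side of Pollack–Weston 2011, Thm. 6.8 (identification (iv) of
`PollackWestonCongruence.lean`), in Gross's original setting `N⁺ = 1` (*Heights and the special
values of L-series*, §1: `N = p` prime, `B` the definite quaternion algebra of discriminant `p`,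
`R` a maximal order): for every squarefree `N⁻` with an odd number of prime factors there is a
definite quaternion algebra over `ℚ` ramified exactly at the primes dividing `N⁻`, and it contains
a maximal order, i.e. an Eichler order of level `1`. Hence

* `Brandt.nonempty_xiSetup_one` — `Nonempty (Brandt.XiSetup 1 N⁻)`: the definite congruence number
  `brandtXi 1 N⁻ λ` of `BrandtXi.lean` is the `ξ` of an actual Brandt module, not the junk `0`;
* `nonempty_eichlerPackage_one` — `Nonempty (EichlerPackage 1 N⁻)`: the case `N⁺ = 1` of the
  named fact `nonempty_eichlerPackage` of `BrandtModule.lean`, so that `brandtModule 1 N⁻` is the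
  Brandt data of an Eichler package (`brandtModule_one_eq`).

Ingredients, all theorems of the tree: the classification/existence of rational quaternion
algebras with prescribed even ramification `exists_isQuaternionAlgebra_of_even_rat`
(Vignéras III §3 Thm. 3.1 over `ℚ`, from Hilbert reciprocity), applied to
`S = {places over p ∣ N⁻}`, `T = {∞}` (`|S| + |T| = ω(N⁻) + 1` even); total definiteness is
"ramified at the (unique, real) infinite place of `ℚ`"; the existence of maximal orders
`exists_isEichlerOrder_one_of_isTotallyDefinite` (Vignéras I §4 Prop. 4.2,
`QuaternionMaximalOrder.lean`); and the dictionary `p_v ∣ n ↔ (n) ⊆ v` between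
`Rat.HeightOneSpectrum.primesEquiv` and divisibility. Eichler orders of level `N⁺ > 1` (the
general case of `nonempty_eichlerPackage`) need the local theory of orders and are not treated.

## References

* M.-F. Vignéras, *Arithmétique des algèbres de quaternions*, LNM 800 (1980), Ch. III §3
  Thm. 3.1, Ch. I §4 Prop. 4.2 [VignerasLNM800].
* B. H. Gross, *Heights and the special values of L-series*, CMS Conf. Proc. 7 (1987), §1
  [Gross1987].
-/

noncomputable section

open NumberField IsDedekindDomain

namespace Literature.NumberTheory.Automorphic

/-- **Definite quaternion algebras over `ℚ` of prescribed squarefree discriminant with an odd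
number of prime factors exist**, in the format of `Brandt.XiSetup`: a totally definite quaternion
algebra over `ℚ` with `ramifiedPlaces = {v | p_v ∣ N⁻}` (Vignéras III §3 Thm. 3.1 over `ℚ`: the
ramification set `{p ∣ N⁻} ∪ {∞}` has even cardinality). [cite: VignerasLNM800, Ch. III §3 Thm. 3.1] -/
theorem exists_isTotallyDefinite_ramifiedPlaces_eq {Nminus : ℕ} (hsq : Squarefree Nminus)
    (hodd : Odd Nminus.primeFactors.card) :
    ∃ (D : Type) (_ : Ring D) (_ : Algebra ℚ D), IsQuaternionAlgebra ℚ D ∧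
      IsTotallyDefinite ℚ D ∧
        ramifiedPlaces ℚ D =
          {v | ((Rat.HeightOneSpectrum.primesEquiv v : Nat.Primes) : ℕ) ∣ Nminus} := by
  classical
  let e : HeightOneSpectrum (𝓞 ℚ) ≃ Nat.Primes := Rat.HeightOneSpectrum.primesEquiv
  let S : Finset (HeightOneSpectrum (𝓞 ℚ)) :=
    Nminus.primeFactors.attach.image fun p => e.symm ⟨p.1, Nat.prime_of_mem_primeFactors p.2⟩
  let T : Finset (InfinitePlace ℚ) := Finset.univ
  have hT : ∀ w ∈ T, w.IsReal := fun w _ => NumberField.IsTotallyReal.isReal w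
  have hScard : S.card = Nminus.primeFactors.card := by
    rw [Finset.card_image_of_injective _ fun p q hpq => ?_, Finset.card_attach]
    have h := congrArg Subtype.val (e.symm.injective hpq)
    exact Subtype.ext h
  have hTcard : T.card = 1 := by
    rw [Finset.card_univ, Fintype.card_unique]
  have heven : Even (S.card + T.card) := by
    rw [hScard, hTcard]
    exact hodd.add_one
  obtain ⟨D, instR, instA, hQ, hram, hraminf⟩ := exists_isQuaternionAlgebra_of_even_rat S T hT heven
  refine ⟨D, instR, instA, hQ, fun w => ?_, ?_⟩
  · show w ∈ ramifiedInfinitePlaces ℚ D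
    rw [hraminf]
    exact Finset.mem_coe.mpr (Finset.mem_univ w)
  · ext v
    rw [hram, Finset.mem_coe, Set.mem_setOf_eq]
    constructor
    · intro hv
      obtain ⟨p, -, rfl⟩ := Finset.mem_image.mp hv
      rw [show Rat.HeightOneSpectrum.primesEquiv (e.symm _) = e (e.symm _) from rfl,
        Equiv.apply_symm_apply]
      exact Nat.dvd_of_mem_primeFactors p.2
    · intro hv
      have hp : ((e v : Nat.Primes) : ℕ) ∈ Nminus.primeFactors :=
        Nat.mem_primeFactors.mpr ⟨(e v).2, hv, hsq.ne_zero⟩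
      refine Finset.mem_image.mpr ⟨⟨(e v : ℕ), hp⟩, Finset.mem_attach _ _, ?_⟩
      have : (⟨((e v : Nat.Primes) : ℕ), Nat.prime_of_mem_primeFactors hp⟩ : Nat.Primes) = e v :=
        Subtype.ext rfl
      rw [this, Equiv.symm_apply_apply]

/-- **Brandt setups of level `(1, N⁻)` exist** for every squarefree `N⁻` with an odd number of
prime factors: a definite quaternion algebra over `ℚ` of discriminant `N⁻` with a maximal order
(an Eichler order of level `1`) — Gross's `(B, R)` for `N⁻ = p`. Consequently `brandtXi 1 N⁻ λ` is
evaluated on an actual setup. [cite: VignerasLNM800, Ch. III §3 Thm. 3.1 and Ch. I §4 Prop. 4.2] -/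
theorem Brandt.nonempty_xiSetup_one {Nminus : ℕ} (hsq : Squarefree Nminus)
    (hodd : Odd Nminus.primeFactors.card) : Nonempty (Brandt.XiSetup 1 Nminus) := by
  obtain ⟨D, instR, instA, hQ, hdef, hram⟩ := exists_isTotallyDefinite_ramifiedPlaces_eq hsq hodd
  haveI := hQ
  obtain ⟨O, hO⟩ := exists_isEichlerOrder_one_of_isTotallyDefinite hdef
  exact ⟨{ D := D, isTotallyDefinite := hdef, squarefree := hsq, ramifiedPlaces_eq := hram, O := O,
           isEichlerOrder := hO }⟩

/-- `brandtXi 1 N⁻ λ` is the `ξ` of some setup (not the junk value for lack of a setup). [folklore] -/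
theorem exists_brandtXi_one_eq {Nminus : ℕ} (hsq : Squarefree Nminus)
    (hodd : Odd Nminus.primeFactors.card) (lam : ℕ → ℤ) :
    ∃ S : Brandt.XiSetup 1 Nminus, brandtXi 1 Nminus lam = S.xi lam :=
  exists_brandtXi_eq (Brandt.nonempty_xiSetup_one hsq hodd) lam

/-- **Eichler packages of level `(1, N⁻)` exist** (the case `N⁺ = 1` of the named fact
`nonempty_eichlerPackage` of `BrandtModule.lean`, proved): for `N⁻` squarefree with an odd
number of prime factors there is a definite quaternion algebra over `ℚ` ramified exactly at the
primes dividing `N⁻` with an Eichler order of level `1`. [cite: VignerasLNM800, Ch. III §3 Thm. 3.1 and Ch. I §4 Prop. 4.2] -/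
theorem nonempty_eichlerPackage_one {Nminus : ℕ} (hsq : Squarefree Nminus)
    (hodd : Odd Nminus.primeFactors.card) : Nonempty (EichlerPackage 1 Nminus) :=
  (Brandt.nonempty_xiSetup_iff.mp (Brandt.nonempty_xiSetup_one hsq hodd)).1

/-- At level `(1, N⁻)` the Brandt module of `BrandtModule.lean` is the Brandt data of an Eichler
package (not the empty junk data), unconditionally. [folklore] -/
theorem brandtModule_one_eq {Nminus : ℕ} (hsq : Squarefree Nminus)
    (hodd : Odd Nminus.primeFactors.card) :
    brandtModule 1 Nminus =
      (brandtPackage 1 Nminus (nonempty_eichlerPackage_one hsq hodd)).brandtData :=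
  brandtModule_eq _

end Literature.NumberTheory.Automorphic

end
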